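import Summits.ResolutionOfSingularities.ResolutionOfSingularities.Theorems.PurelyInseparableDim4Perm2BoundOrigin
import Summits.ResolutionOfSingularities.ResolutionOfSingularities.Theorems.PurelyInseparableDim4Target
import HarnessLib

/-!
# [OURS · res-dim4-pi PR-2, part 2] The PERM2-0 rise bound `d′ ≤ 2d − g` at the chart origin, and
  «(1) ∧ (2) ∧ loss-free ⇒ d′ ≤ d» (Hauser–Perlega, `e = 1`)

Cell `res-dim4-pi` (D-0157 DOOR 2, wave 2), brick **PR-2** (desk `boards/WAVE2.md`), seat `res-dim4-p-2`;
part 2 of 2 (part 1 = `PurelyInseparableDim4Perm2BoundOrigin.lean`: the chart-origin dictionary). Over the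
tree's `CentreBlowup.step / shade / ordAlong / degIn` and the cell's target frame `PIDim4.State / Perm2 /
RiseD / IsPermissibleCentre` (`PurelyInseparableDim4Target.lean`); nothing is restated. Notation as in part 1:
`F = x^r · G` clean, `d = ord₀ G = o − |r|` (the shade, letter `d = resordHP`), centre `V(z, x_S)` with
condition (1) `F ∈ (x_S)^q`, `g := ord_{(x_S)} G = ordAlong S F − degIn S r` (engines' `dGamma`; `g ≤ d`,
and `g = d` ⟺ condition (2) ⟺ `perm2 = 1`), chart `x_j`, `j ∈ S`.

## What is proved
§1.4 (continued; any `q`, chart ORIGIN `b = 0`):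
* `le_shade_step_origin_add_iff` — **`d′ + g = min over the monomials x^ε of G of (|ε| + deg_{S∖j} ε)`**;
* `shade_le_shade_step_origin_add : d ≤ d′ + g`; **`shade_step_origin_add_le : d′ + g ≤ 2d`** — the
  PERM2-0 RISE BOUND `d′ ≤ 2d − g` (rise `≤ d − g`; crit-2 CN-B-2 «`G(σx) = x_j^{ord_Γ G}·G̃`, `ord G̃` up
  to `2d − ord_Γ G`», crit-1 T-A-02); equality case `shade_step_origin_add_eq_two_mul_iff` (`d′ = 2d − g`
  ⟺ every `x^ε` of `G` has `|ε| + deg_{S∖j} ε ≥ 2d`); rise criterion `shade_lt_shade_step_origin_iff`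
  (RISE:d ⟺ every `x^ε` of `G` has `|ε| + deg_{S∖j} ε > d + g`);
* **`shade_step_origin_le_of_perm` : (1) ∧ (2) ⇒ `d′ ≤ d` at the origin, for EVERY `q = p^e`**
  (`…_of_shade_le`: the same from `d ≤ g`); `shade_step_origin_singleton : S = {j} ⇒ d′ = d − g`.
§2 (`q = p` prime, `char K = p`, points `b` over the origin of the centre: `b_j = 0`, `b = 0` off `S`):
* **`shade_step_le_of_lossFree`** — «(1) ∧ (2) ⇒ `d′ ≤ d` on LOSS-FREE edges» (`r_i ≠ 0 ⇒ b_i = 0`), from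
  the tree's `shade_step_le_shade_pointStep` + `PointBlowup.necessary_of_shadeIncreases` (a rise at order
  `p` forces a lost component `x_i`, `r_i ≥ 1`, with an initial exponent prime to `p`).
§3 in the cell's words (`State K = CState (Fin 4) K`): `perm2_iff_forall`, `not_riseD_origin_of_perm2`,
  `shade_origin_add_ordAlong_le : d′ + ordAlong S F ≤ 2d + degIn S r ∧ d + degIn S r ≤ d′ + ordAlong S F`,
  `not_riseD_of_perm2_of_lossFree`.

Checks by hand (desk JUMPS J-002 = crit-2 CN-B-2 specimen): `G = w² + x y³ u¹⁰`, `S = {x, w}`, `j = x`,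
`q = 2`: `g = 1 < d = 2`, `min_ε (|ε| + deg_w ε) = min (2 + 2, 14 + 0) = 4`, so `d′ = 3 = 2d − g` (RISE with
equality, as logged); crit-1 T-A-02: `G = x₂² + x₄⁹`, `S = {2,3}`, `j = 3`: `g = 0`, `d′ = min (2+2, 9+0) = 4`.

## What is NOT proved (honest scope)
PERM2-0 edges at TRANSLATED points `t ≠ 0` are not bounded here; §2 is `e = 1` and fibre-over-the-origin
only (points moving ALONG the centre are brick PR-1); Hauser–Perlega's printed statement is re-proved in
the model at `e = 1`, not imported. [OURS · counted 0 · AI work weaker than expert review] NOTHING here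
proves resolution of singularities in dimension ≥ 4 / characteristic `p`; these are theorems about OUR
candidate frame (MODE 1h coordinate game) — census value: the engines' PERM2-0 / STRUCTURAL rise
population becomes a KNOWN-with-bound class, and HP-permissible loss-free edges carry no RISE:d.
bears_on: LADDER-RESOLUTION:D157-DOOR2 (res-dim4-pi · PR-2). Supports stmt-ResolutionOfSingularities-16155
(helper).
-/

noncomputable section

set_option linter.dupNamespace false -- mandated namespace of this single-conjunct summit

open MvPolynomial Finset

open scoped BigOperators

namespace Summit.ResolutionOfSingularities.ResolutionOfSingularities.Theorems.PIDim4

namespace Perm2Bound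

open Literature.AlgebraicGeometry.Resolution
open Literature.AlgebraicGeometry.Resolution.CentreBlowup
open Literature.AlgebraicGeometry.Resolution.Hauser2010
open Literature.Barriers.ResolutionOfSingularities (ordZero_le_of_coeff_ne_zero le_ordZero_of_forall)

/-! ## §1.4 (continued) The origin law in the letter `d`; the rise bound; the equality and rise criteria -/

section Origin

variable {σ : Type*} {K : Type*} [Field K] [Fintype σ] [DecidableEq σ] [DecidableEq K]

/-- **THE ORIGIN LAW in the letter `d`**: at the chart origin, `m ≤ d′ + g ⟺` every monomial `x^e` of
`F` has `m + |r| + degIn (S∖j) r ≤ |e| + degIn (S∖j) e`, i.e. — writing `x^e = x^r · x^ε` —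
**`d′ + g = min over the monomials x^ε of G of (|ε| + deg_{S∖j} ε)`**. [folklore] -/
theorem le_shade_step_origin_add_iff {q : ℕ} {S : Finset σ} {j : σ} (hj : j ∈ S) (b : σ → K)
    (hb0 : ∀ i, b i = 0) (s : CState σ K) (hclean : deletePthPowers q s.F = s.F)
    (hq : ∀ e ∈ s.F.support, q ≤ degIn S e) {o : ℕ} (ho : ordZero s.F = o)
    (hr : ∀ d ∈ s.F.support, s.r ≤ d) {g : ℕ}
    (hg : ordAlong S s.F = ((degIn S s.r + g : ℕ) : ℕ∞)) (m : ℕ) :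
    ((m : ℕ) : ℕ∞) ≤ (step q S j b s).shade + (g : ℕ∞) ↔
      ∀ d ∈ s.F.support,
        m + s.r.degree + degIn (S.erase j) s.r ≤ d.degree + degIn (S.erase j) d := by
  obtain ⟨o', ho', hr', hgo, hqo, hiff, ⟨d₀, hd₀, hd₀o, hd₀T⟩, hall⟩ :=
    origin_arith hj b hb0 s hclean hq ho hr hg
  rw [CState.shade_eq_of_ordZero_eq _ ho']
  have hlow : o + degIn (S.erase j) s.r - q ≤ o' :=
    (hiff _).mpr fun d hd => by have := hall d hd; omega
  constructor
  · intro h d hd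
    have h' : m ≤ o' - (step q S j b s).r.degree + g := by exact_mod_cast h
    have h1 := (hiff o').mp le_rfl d hd
    have h2 := hall d hd
    omega
  · intro h
    by_cases hm : q ≤ m + s.r.degree + degIn (S.erase j) s.r
    · have h1 : m + s.r.degree + degIn (S.erase j) s.r - q ≤ o' :=
        (hiff _).mpr fun d hd => by have := h d hd; omega
      exact_mod_cast (show m ≤ o' - (step q S j b s).r.degree + g by omega)
    · exact_mod_cast (show m ≤ o' - (step q S j b s).r.degree + g by omega)

/-- **The drop at the origin is at most `g`**: `d ≤ d′ + g`. [folklore] -/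
theorem shade_le_shade_step_origin_add {q : ℕ} {S : Finset σ} {j : σ} (hj : j ∈ S) (b : σ → K)
    (hb0 : ∀ i, b i = 0) (s : CState σ K) (hclean : deletePthPowers q s.F = s.F)
    (hq : ∀ e ∈ s.F.support, q ≤ degIn S e) {o : ℕ} (ho : ordZero s.F = o)
    (hr : ∀ d ∈ s.F.support, s.r ≤ d) {g : ℕ}
    (hg : ordAlong S s.F = ((degIn S s.r + g : ℕ) : ℕ∞)) :
    s.shade ≤ (step q S j b s).shade + (g : ℕ∞) := by
  obtain ⟨-, -, -, hgo, -, -, -, hall⟩ := origin_arith hj b hb0 s hclean hq ho hr hg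
  rw [CState.shade_eq_of_ordZero_eq s ho]
  exact (le_shade_step_origin_add_iff hj b hb0 s hclean hq ho hr hg _).mpr
    fun d hd => by have := hall d hd; omega

/-- **THE PERM2-0 RISE BOUND `d′ ≤ 2d − g`** (rise `≤ d − g`) at the chart origin of a Hironaka-permissible
coordinate centre (condition (1) only), every exponent `q`: an initial monomial `x^{ε₀}` of `G`
(`|ε₀| = d`) survives as `x_j^{deg_S ε₀ − g} · x^{ε₀ off j}` of degree `d + deg_{S∖j} ε₀ − g ≤ 2d − g`
(crit-2 CN-B-2 «`G(σx) = x_j^{ord_Γ G}·G̃`, `ord G̃` up to `2d − ord_Γ G`»; crit-1 T-A-02). [folklore] -/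
theorem shade_step_origin_add_le {q : ℕ} {S : Finset σ} {j : σ} (hj : j ∈ S) (b : σ → K)
    (hb0 : ∀ i, b i = 0) (s : CState σ K) (hclean : deletePthPowers q s.F = s.F)
    (hq : ∀ e ∈ s.F.support, q ≤ degIn S e) {o : ℕ} (ho : ordZero s.F = o)
    (hr : ∀ d ∈ s.F.support, s.r ≤ d) {g : ℕ}
    (hg : ordAlong S s.F = ((degIn S s.r + g : ℕ) : ℕ∞)) :
    (step q S j b s).shade + (g : ℕ∞) ≤ 2 * s.shade := by
  obtain ⟨o', ho', hr', hgo, hqo, hiff, ⟨d₀, hd₀, hd₀o, hd₀T⟩, hall⟩ :=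
    origin_arith hj b hb0 s hclean hq ho hr hg
  rw [CState.shade_eq_of_ordZero_eq _ ho', CState.shade_eq_of_ordZero_eq s ho]
  have h1 := (hiff o').mp le_rfl d₀ hd₀
  have h2 := hall d₀ hd₀
  exact_mod_cast (show o' - (step q S j b s).r.degree + g ≤ 2 * (o - s.r.degree) by omega)

/-- **Equality case of the rise bound**: `d′ = 2d − g` iff every monomial `x^ε` of `G` has
`|ε| + deg_{S∖j} ε ≥ 2d` (in particular every initial monomial of `G` is supported on `S ∖ j`).
[folklore] -/
theorem shade_step_origin_add_eq_two_mul_iff {q : ℕ} {S : Finset σ} {j : σ} (hj : j ∈ S)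
    (b : σ → K) (hb0 : ∀ i, b i = 0) (s : CState σ K) (hclean : deletePthPowers q s.F = s.F)
    (hq : ∀ e ∈ s.F.support, q ≤ degIn S e) {o : ℕ} (ho : ordZero s.F = o)
    (hr : ∀ d ∈ s.F.support, s.r ≤ d) {g : ℕ}
    (hg : ordAlong S s.F = ((degIn S s.r + g : ℕ) : ℕ∞)) :
    (step q S j b s).shade + (g : ℕ∞) = 2 * s.shade ↔
      ∀ d ∈ s.F.support,
        2 * (o - s.r.degree) + s.r.degree + degIn (S.erase j) s.r ≤ d.degree + degIn (S.erase j) d := by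
  have hle := shade_step_origin_add_le hj b hb0 s hclean hq ho hr hg
  have hiff := le_shade_step_origin_add_iff hj b hb0 s hclean hq ho hr hg (2 * (o - s.r.degree))
  have h2 : (2 : ℕ∞) * s.shade = ((2 * (o - s.r.degree) : ℕ) : ℕ∞) := by
    rw [CState.shade_eq_of_ordZero_eq s ho]; push_cast; rfl
  rw [h2] at hle ⊢
  rw [← hiff]
  exact ⟨fun h => h.ge, fun h => le_antisymm hle h⟩

/-- **RISE:d at the chart origin** iff every monomial `x^ε` of `G` has `|ε| + deg_{S∖j} ε > d + g`
(so `g = d` forbids a rise, and a PERM2-0 rise needs EVERY initial monomial of `G` to carry more than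
`g` in the variables of `S ∖ j`). [folklore] -/
theorem shade_lt_shade_step_origin_iff {q : ℕ} {S : Finset σ} {j : σ} (hj : j ∈ S) (b : σ → K)
    (hb0 : ∀ i, b i = 0) (s : CState σ K) (hclean : deletePthPowers q s.F = s.F)
    (hq : ∀ e ∈ s.F.support, q ≤ degIn S e) {o : ℕ} (ho : ordZero s.F = o)
    (hr : ∀ d ∈ s.F.support, s.r ≤ d) {g : ℕ}
    (hg : ordAlong S s.F = ((degIn S s.r + g : ℕ) : ℕ∞)) :
    s.shade < (step q S j b s).shade ↔
      ∀ d ∈ s.F.support, o + degIn (S.erase j) s.r + g < d.degree + degIn (S.erase j) d := by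
  obtain ⟨o', ho', hr', hgo, hqo, -, -, -⟩ := origin_arith hj b hb0 s hclean hq ho hr hg
  have hiff := le_shade_step_origin_add_iff hj b hb0 s hclean hq ho hr hg (o - s.r.degree + g + 1)
  have key : s.shade < (step q S j b s).shade ↔
      (((o - s.r.degree + g + 1 : ℕ) : ℕ) : ℕ∞) ≤ (step q S j b s).shade + (g : ℕ∞) := by
    rw [CState.shade_eq_of_ordZero_eq s ho, CState.shade_eq_of_ordZero_eq _ ho']
    constructor
    · intro h
      have h' : o - s.r.degree < o' - (step q S j b s).r.degree := by exact_mod_cast h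
      exact_mod_cast (show o - s.r.degree + g + 1 ≤ o' - (step q S j b s).r.degree + g by omega)
    · intro h
      have h' : o - s.r.degree + g + 1 ≤ o' - (step q S j b s).r.degree + g := by exact_mod_cast h
      exact_mod_cast (show o - s.r.degree < o' - (step q S j b s).r.degree by omega)
  rw [key, hiff]
  constructor
  · intro h d hd; have := h d hd; omega
  · intro h d hd; have := h d hd; omega

/-- **Conditions (1) ∧ (2) forbid a rise at the chart origin, for EVERY exponent `q = p^e`**: if also
`G ∈ (x_S)^d` (Hauser–Perlega's (2) / Moh's (3), the engines' `perm2 = 1`; then `g = d`) the shade does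
not increase at `b = 0`. [folklore] -/
theorem shade_step_origin_le_of_perm {q : ℕ} {S : Finset σ} {j : σ} (hj : j ∈ S) (b : σ → K)
    (hb0 : ∀ i, b i = 0) (s : CState σ K) (hclean : deletePthPowers q s.F = s.F)
    (hq : ∀ e ∈ s.F.support, q ≤ degIn S e) {o : ℕ} (ho : ordZero s.F = o)
    (hr : ∀ d ∈ s.F.support, s.r ≤ d)
    (hperm : ∀ d ∈ s.F.support, degIn S s.r + (o - s.r.degree) ≤ degIn S d) :
    (step q S j b s).shade ≤ s.shade := by
  have hg : ordAlong S s.F = ((degIn S s.r + (o - s.r.degree) : ℕ) : ℕ∞) :=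
    (ordAlong_eq_of_perm S s ho hr hperm).1
  obtain ⟨o', ho', hr', hgo, hqo, hiff, ⟨d₀, hd₀, hd₀o, hd₀T⟩, hall⟩ :=
    origin_arith hj b hb0 s hclean hq ho hr hg
  rw [CState.shade_eq_of_ordZero_eq _ ho', CState.shade_eq_of_ordZero_eq s ho]
  have h1 := (hiff o').mp le_rfl d₀ hd₀
  have h2 := hall d₀ hd₀
  exact_mod_cast (show o' - (step q S j b s).r.degree ≤ o - s.r.degree by omega)

/-- The same with condition (2) given as `d ≤ g`. [folklore] -/
theorem shade_step_origin_le_of_shade_le {q : ℕ} {S : Finset σ} {j : σ} (hj : j ∈ S) (b : σ → K)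
    (hb0 : ∀ i, b i = 0) (s : CState σ K) (hclean : deletePthPowers q s.F = s.F)
    (hq : ∀ e ∈ s.F.support, q ≤ degIn S e) {o : ℕ} (ho : ordZero s.F = o)
    (hr : ∀ d ∈ s.F.support, s.r ≤ d) {g : ℕ}
    (hg : ordAlong S s.F = ((degIn S s.r + g : ℕ) : ℕ∞)) (h2 : s.shade ≤ (g : ℕ∞)) :
    (step q S j b s).shade ≤ s.shade := by
  have hle := shade_step_origin_add_le hj b hb0 s hclean hq ho hr hg
  have hgle := le_shade_of_ordAlong_eq S s ho hr hg
  obtain ⟨o', ho', -⟩ := origin_arith hj b hb0 s hclean hq ho hr hg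
  rw [CState.shade_eq_of_ordZero_eq _ ho', CState.shade_eq_of_ordZero_eq s ho] at *
  have hle' : o' - (step q S j b s).r.degree + g ≤ 2 * (o - s.r.degree) := by exact_mod_cast hle
  have h2' : o - s.r.degree ≤ g := by exact_mod_cast h2
  have hgle' : g ≤ o - s.r.degree := by exact_mod_cast hgle
  exact_mod_cast (show o' - (step q S j b s).r.degree ≤ o - s.r.degree by omega)

/-- **The exceptional-divisor step `S = {j}`** (the census' DIV edges): `d′ = d − g` exactly
(`g = ord_{x_j} G`). [folklore] -/
theorem shade_step_origin_singleton {q : ℕ} {j : σ} (b : σ → K) (hb0 : ∀ i, b i = 0)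
    (s : CState σ K) (hclean : deletePthPowers q s.F = s.F)
    (hq : ∀ e ∈ s.F.support, q ≤ degIn {j} e) {o : ℕ} (ho : ordZero s.F = o)
    (hr : ∀ d ∈ s.F.support, s.r ≤ d) {g : ℕ}
    (hg : ordAlong {j} s.F = ((degIn {j} s.r + g : ℕ) : ℕ∞)) :
    (step q {j} j b s).shade + (g : ℕ∞) = s.shade := by
  have hj : j ∈ ({j} : Finset σ) := Finset.mem_singleton_self j
  refine le_antisymm ?_ (shade_le_shade_step_origin_add hj b hb0 s hclean hq ho hr hg)
  obtain ⟨o', ho', hr', hgo, hqo, hiff, ⟨d₀, hd₀, hd₀o, hd₀T⟩, hall⟩ :=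
    origin_arith hj b hb0 s hclean hq ho hr hg
  rw [CState.shade_eq_of_ordZero_eq _ ho', CState.shade_eq_of_ordZero_eq s ho]
  have h1 := (hiff o').mp le_rfl d₀ hd₀
  have hT : ∀ e : σ →₀ ℕ, degIn (({j} : Finset σ).erase j) e = 0 := fun e => by
    rw [Finset.erase_singleton, degIn_empty]
  rw [hT] at h1 hr'
  exact_mod_cast (show o' - (step q {j} j b s).r.degree + g ≤ o - s.r.degree by omega)

end Origin

/-! ## §2 Loss-free edges under conditions (1) ∧ (2) at `e = 1` (Hauser–Perlega) -/

section LossFree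

variable {σ : Type*} {K : Type*} [Field K] [Fintype σ] [DecidableEq σ] [DecidableEq K]
variable (p : ℕ) [hp : Fact p.Prime] [CharP K p]

/-- **«(1) ∧ (2) ⇒ `d′ ≤ d` on loss-free edges» at `e = 1`.** Let `s = (F, r)` be clean with
`x^r ∣ F`, `S ∋ j` a coordinate centre with (1) `F ∈ (x_S)^p` and (2) `G ∈ (x_S)^d` (Moh– and HP-permissible),
and `b` a point of the `x_j`-chart over the origin of the centre (`b_j = 0`, `b_i = 0` off `S`) at which
NO exceptional component of positive multiplicity is lost (`r_i ≠ 0 ⇒ b_i = 0`). Then the shade does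
not increase. Proof: an increase would survive the transfer to the point blow-up with the same chart
and point (`CentreBlowup.shade_step_le_shade_pointStep`), where at order `p` it forces a LOST component
`x_i`, `r_i ≥ 1`, with an initial exponent prime to `p` (`PointBlowup.necessary_of_shadeIncreases`,
Hauser–Perlega's (7) / comment (d), Moh's witness) — contradiction. This is why HP impose (2): with it,
rises live only at translated points that lose components (kangaroo points); without it (PERM2-0) §1
bounds the rise at the origin by `d − g`. [cite: HauserPerlega2019PRIMS, §3 Theorem (7) and Comment (d)]
[cite: Moh1987, §1 (p. 972)] -/
theorem shade_step_le_of_lossFree {S : Finset σ} {j : σ} (hj : j ∈ S) (b : σ → K) (hbj : b j = 0)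
    (hbN : ∀ i, i ∉ S → b i = 0) (s : CState σ K) (hloss : ∀ i, s.r i ≠ 0 → b i = 0)
    (hclean : deletePthPowers p s.F = s.F) {o : ℕ} (ho : ordZero s.F = o)
    (hr : ∀ d ∈ s.F.support, s.r ≤ d) (hq : ∀ d ∈ s.F.support, p ≤ degIn S d)
    (hperm : ∀ d ∈ s.F.support, degIn S s.r + (o - s.r.degree) ≤ degIn S d) :
    (step p S j b s).shade ≤ s.shade := by
  by_contra hlt
  have hinc : s.shade < (step p S j b s).shade := not_le.mp hlt
  obtain ⟨hpo, -, -⟩ := le_of_forall_le_degIn S s ho hr hperm hq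
  have hcmp := shade_step_le_shade_pointStep p hj b hbj hbN s ho hr hq hperm
  have hinc' : PointBlowup.ShadeIncreases p j b s.toState := by
    unfold PointBlowup.ShadeIncreases
    exact lt_of_lt_of_le hinc hcmp
  obtain ⟨-, -, i, -, hbi, hri, -⟩ :=
    PointBlowup.necessary_of_shadeIncreases p j b hbj s.toState hclean ho hpo hr hinc'
  exact hbi (hloss i hri)

/-- Loss-free edges under (1) ∧ (2) at `e = 1` carry no `ShadeIncreases`. [cite: HauserPerlega2019PRIMS, §3 Theorem (7) and Comment (d)] -/
theorem not_shadeIncreases_of_lossFree {S : Finset σ} {j : σ} (hj : j ∈ S) (b : σ → K)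
    (hbj : b j = 0) (hbN : ∀ i, i ∉ S → b i = 0) (s : CState σ K)
    (hloss : ∀ i, s.r i ≠ 0 → b i = 0) (hclean : deletePthPowers p s.F = s.F) {o : ℕ}
    (ho : ordZero s.F = o) (hr : ∀ d ∈ s.F.support, s.r ≤ d)
    (hq : ∀ d ∈ s.F.support, p ≤ degIn S d)
    (hperm : ∀ d ∈ s.F.support, degIn S s.r + (o - s.r.degree) ≤ degIn S d) :
    ¬ ShadeIncreases p S j b s :=
  not_lt.mpr (shade_step_le_of_lossFree p hj b hbj hbN s hloss hclean ho hr hq hperm)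

end LossFree

end Perm2Bound

/-! ## §3 In the cell's vocabulary: `PIDim4.State K`, `IsPermissibleCentre`, `Perm2`, `RiseD` -/

section Cell

open Literature.AlgebraicGeometry.Resolution
open Literature.AlgebraicGeometry.Resolution.CentreBlowup
open Literature.AlgebraicGeometry.Resolution.Hauser2010

variable {K : Type} [Field K] [DecidableEq K]

omit [DecidableEq K] in
/-- Condition (1) of the target frame, monomialwise: a Hironaka-permissible coordinate centre has
`q ≤ degIn S e` on every monomial `x^e` of `F`. [cite: HauserPerlega2019PRIMS, §2 (condition (1) f ∈ P^{c!})] -/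
theorem forall_le_degIn_of_isPermissibleCentre {q : ℕ} {S : Finset (Fin 4)}
    {F : MvPolynomial (Fin 4) K} (hS : IsPermissibleCentre q S F) :
    ∀ e ∈ F.support, q ≤ degIn S e := fun e he => by
  have := le_ordAlong_iff.mp hS.2 e he
  exact_mod_cast this

omit [DecidableEq K] in
/-- **The bit `perm2`, monomialwise**: for a state with `x^r ∣ F` of order `o`, `Perm2 S s` iff every
monomial `x^e` of `F` has `degIn S e ≥ degIn S r + d` (`d = o − |r|`) — the hypothesis `hperm` of the
tree's `CentreBlowupMohStability` theorems. [cite: HauserPerlega2019PRIMS, §2 (condition (2))] -/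
theorem perm2_iff_forall (S : Finset (Fin 4)) (s : State K) {o : ℕ} (ho : ordZero s.F = o) :
    Perm2 S s ↔ ∀ d ∈ s.F.support, degIn S s.r + (o - s.r.degree) ≤ degIn S d := by
  unfold Perm2
  rw [CState.shade_eq_of_ordZero_eq s ho, ← Nat.cast_add, le_ordAlong_iff]
  constructor
  · intro h d hd
    exact_mod_cast h d hd
  · intro h d hd
    exact_mod_cast h d hd

omit [DecidableEq K] in
/-- For `F ≠ 0` with `x^r ∣ F`, `ordAlong S F = degIn S r + g` for a natural `g` (`= ord_{(x_S)} G`,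
the engines' `dGamma`). [folklore] -/
theorem exists_ordAlong_eq_add (S : Finset (Fin 4)) (s : State K) (hF : s.F ≠ 0)
    (hr : ∀ d ∈ s.F.support, s.r ≤ d) :
    ∃ g : ℕ, ordAlong S s.F = ((degIn S s.r + g : ℕ) : ℕ∞) := by
  obtain ⟨d₁, hd₁, hd₁eq⟩ := exists_mem_support_ordAlong_eq S hF
  have hle : degIn S s.r ≤ degIn S d₁ := degIn_le_degIn_of_le S (hr d₁ hd₁)
  refine ⟨degIn S d₁ - degIn S s.r, ?_⟩
  rw [hd₁eq, Nat.add_sub_cancel' hle]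

/-- **No RISE:d at the chart origin of an HP-permissible centre, class (4,1), every `q`.** For a clean
presented state with `x^r ∣ F`, a centre `S ∋ j` with `IsPermissibleCentre q S F` and `Perm2 S s`, the
edge to the ORIGIN of the `x_j`-chart is not a RISE:d (census: I-2-2 (E2) «NO RISE at `t = 0`»).
[OURS · about the candidate frame] [folklore] -/
theorem not_riseD_origin_of_perm2 {q : ℕ} {S : Finset (Fin 4)} {j : Fin 4} (hj : j ∈ S)
    (b : Fin 4 → K) (hb0 : ∀ i, b i = 0) (s : State K) (hclean : deletePthPowers q s.F = s.F)
    (hr : ∀ d ∈ s.F.support, s.r ≤ d) (hS : IsPermissibleCentre q S s.F) (h2 : Perm2 S s) :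
    ¬ RiseD s (CentreBlowup.step q S j b s) := by
  unfold RiseD
  rw [not_lt]
  by_cases hF : s.F = 0
  · have : s.shade = ⊤ := by
      unfold CState.shade; rw [hF, ordZero_zero, ENat.top_sub_coe]
    rw [this]; exact le_top
  obtain ⟨o, ho⟩ := exists_ordZero_eq_natCast hF
  exact Perm2Bound.shade_step_origin_le_of_perm hj b hb0 s hclean
    (forall_le_degIn_of_isPermissibleCentre hS) ho hr ((perm2_iff_forall S s ho).mp h2)

/-- **The PERM2-0 rise bound in the cell's letters, class (4,1), every `q`**: at the chart origin of a
Hironaka-permissible centre `S ∋ j` (condition (1) only), `d′ + ordAlong S F ≤ 2d + degIn S r`, i.e.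
`d′ ≤ 2d − g` with `g = ordAlong S F − degIn S r = ord_{(x_S)} G` (the engines' `dGamma`); and
`d + degIn S r ≤ d′ + ordAlong S F`, i.e. `d − g ≤ d′`. [OURS · about the candidate frame] [folklore] -/
theorem shade_origin_add_ordAlong_le {q : ℕ} {S : Finset (Fin 4)} {j : Fin 4} (hj : j ∈ S)
    (b : Fin 4 → K) (hb0 : ∀ i, b i = 0) (s : State K) (hclean : deletePthPowers q s.F = s.F)
    (hr : ∀ d ∈ s.F.support, s.r ≤ d) (hS : IsPermissibleCentre q S s.F) :
    (CentreBlowup.step q S j b s).shade + ordAlong S s.F ≤ 2 * s.shade + degIn S s.r ∧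
      s.shade + degIn S s.r ≤ (CentreBlowup.step q S j b s).shade + ordAlong S s.F := by
  by_cases hF : s.F = 0
  · have hsh : s.shade = ⊤ := by
      unfold CState.shade; rw [hF, ordZero_zero, ENat.top_sub_coe]
    have hal : ordAlong S s.F = ⊤ := by rw [hF, ordAlong_zero]
    rw [hsh, hal, add_top, two_mul, top_add, top_add]
    exact ⟨le_rfl, le_top⟩
  obtain ⟨o, ho⟩ := exists_ordZero_eq_natCast hF
  obtain ⟨g, hg⟩ := exists_ordAlong_eq_add S s hF hr
  have hq := forall_le_degIn_of_isPermissibleCentre hS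
  have hup := Perm2Bound.shade_step_origin_add_le hj b hb0 s hclean hq ho hr hg
  have hlow := Perm2Bound.shade_le_shade_step_origin_add hj b hb0 s hclean hq ho hr hg
  rw [hg, Nat.cast_add, add_comm (degIn S s.r : ℕ∞) (g : ℕ∞), ← add_assoc]
  exact ⟨add_le_add hup le_rfl, add_le_add hlow le_rfl⟩

/-- **Hauser–Perlega's loss-free monotonicity in the cell's letters (`q = p`, class (4,1))**: an edge of
an HP-permissible centre (`IsPermissibleCentre p S F ∧ Perm2 S s`) to a point `b` over the origin of the
centre (`b_j = 0`, `b = 0` off `S`) that loses no exceptional component of positive multiplicity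
(`r_i ≠ 0 ⇒ b_i = 0`) is not a RISE:d. [OURS · about the candidate frame]
[cite: HauserPerlega2019PRIMS, §3 Theorem (7) and Comment (d)] -/
theorem not_riseD_of_perm2_of_lossFree (p : ℕ) [Fact p.Prime] [CharP K p] {S : Finset (Fin 4)}
    {j : Fin 4} (hj : j ∈ S) (b : Fin 4 → K) (hbj : b j = 0) (hbN : ∀ i, i ∉ S → b i = 0)
    (s : State K) (hloss : ∀ i, s.r i ≠ 0 → b i = 0) (hclean : deletePthPowers p s.F = s.F)
    (hr : ∀ d ∈ s.F.support, s.r ≤ d) (hS : IsPermissibleCentre p S s.F) (h2 : Perm2 S s) :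
    ¬ RiseD s (CentreBlowup.step p S j b s) := by
  unfold RiseD
  rw [not_lt]
  by_cases hF : s.F = 0
  · have : s.shade = ⊤ := by
      unfold CState.shade; rw [hF, ordZero_zero, ENat.top_sub_coe]
    rw [this]; exact le_top
  obtain ⟨o, ho⟩ := exists_ordZero_eq_natCast hF
  exact Perm2Bound.shade_step_le_of_lossFree p hj b hbj hbN s hloss hclean ho hr
    (forall_le_degIn_of_isPermissibleCentre hS) ((perm2_iff_forall S s ho).mp h2)

end Cell

end Summit.ResolutionOfSingularities.ResolutionOfSingularities.Theorems.PIDim4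

end
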